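import Mathlib
import Summits.Ventures.CertifiedArithmetic.LowPrec.OptSearchGainSSE

/-!
# Opt / R4 — Theorem S4 (SSE): the two candidate scales suffice exactly for block sizes `k ≤ T² + 1`, and the threshold is tight (E2M1 `145`, E2M3 `3601`, E3M2 `200705`)

HONEST FRAMING: certified error envelopes and provably optimal rounding/accumulation schemes for
low-precision formats under stated cost models; every table by two implementations; no hardware or
vendor claims.

OPTIMA.md Theorem S4 in the units of `OptTwoCandidates.lean` / `OptSearchGainSSE.lean` (cost model CM-S:
one shared power-of-two scale per block, objective = block sum of squared errors): the block maximum `a`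
satisfies `T u < a ≤ 2 T u`, so the non-clipping power-of-two scale is `2u` (grid `(2u) • B`) and the half
candidate is `u` (grid `u • B`, which clips `a`). THEOREM S4 (`sse_finer_lt_half`, `sse_two_candidates`;
instances `sse_two_candidates_e2m1/_e2m3/_e3m2`): for every block of size `k ≤ T² + 1` every finer scale
`u / 2^j`, `j ≥ 1`, is STRICTLY worse than `u` in block SSE, and every coarser scale is never better than
`2u` (`sse_coarser_le`); hence `min over ALL power-of-two scales of SSE = min (SSE(2u), SSE(u))` — the two
candidates suffice, with the threshold `K₂(F) = T² + 1 = (M/δ)² + 1` (E2M1 `145`, E2M3 `3601`,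
E3M2 `200705`; certificate C2 field `k_exclusion_max`, two implementations, code/opt). TIGHTNESS
(`sse_third_scale_wins`; instances `_e2m1/_e2m3/_e3m2`): for EVERY `k ≥ T² + 2` the block
`(T u + u/(8T), u/2, …, u/2)` of size `k` has `u/2` (window `e_nc - 2`) as its UNIQUE SSE-minimiser among
all power-of-two scales — strictly better than `2u`, than `u`, than every `2^n (2u)` and than every
`u/2^j`, `j ≥ 2` — so the threshold `T² + 1` is exact. Proof of the bound (`top_sq_loss`): the top element
alone loses more than `T² (u/2)²` going from `u` to any finer scale (`(a - T u/2)² - (a - T u)² - T² u²/4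
= T u (a - T u) > 0`), while each of the other `k - 1 ≤ T²` elements gains at most `(u/2)²` (Lemma S2(ii)
one level down, `sq_gain_le_half`). Proof of tightness: with `η = u/(8T)` the four block SSEs are explicit
polynomials in `T, η` (`blockSSE_attBlock`). Proof text: OPTIMA.md Theorem S4 (opt seat, pub-lowprec).
-/

namespace Summit.Ventures.CertifiedArithmetic.LowPrec.Opt

section SSEWindow

variable {K : Type*} [Field K] [LinearOrder K] [IsStrictOrderedRing K]
variable {B : Finset ℕ} (hB : B.Nonempty)

/-- exact clipping error: at or above the top point `T s` (a grid point) the error is `a - T s` -/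
theorem err_eq_sub_top {T : ℕ} (hT : T ∈ B) (hle : ∀ n ∈ B, n ≤ T) {s a : K} (hs : 0 ≤ s)
    (ha : (T : K) * s ≤ a) : err hB s a = a - (T : K) * s := by
  apply le_antisymm
  · have e : s * (T : K) = (T : K) * s := mul_comm _ _
    exact err_le_of_near_abs hB (n := T) hT (by linarith [e]) (by linarith [e])
  · exact sub_top_le_err hB hle hs a

/-- Lemma S2(ii) one level down: `err(u, y)² - err(u/2^j, y)² ≤ (u/2)²` for every `y ≥ 0` and `j ≥ 1` -/
theorem sq_gain_le_half {T Tm L Lm : ℕ} (hT : T ∈ B) (hle : ∀ n ∈ B, n ≤ T) (hTm : Tm ∈ B)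
    (hT2 : 2 * Tm = T) (hL : L ∈ B) (hLm : Lm ∈ B) (hL2 : 2 * Lm = L)
    (hAB : ∀ n ∈ B, L ≤ 2 * n → 2 * n ≤ T → 2 * n ∈ B)
    (hBA : ∀ n ∈ B, L ≤ n → n ≤ T → ∃ m ∈ B, 2 * m = n)
    (hlow : ∀ u y : K, 0 < u → 0 ≤ y → y ≤ (L : K) * u → err hB (2 * u) y ≤ u)
    {u y : K} (hu : 0 < u) (hy0 : 0 ≤ y) {j : ℕ} (hj : 1 ≤ j) :
    err hB u y ^ 2 - err hB (u / 2 ^ j) y ^ 2 ≤ (u / 2) ^ 2 := by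
  obtain ⟨i, rfl⟩ := Nat.exists_eq_add_of_le hj
  have hu2 : 0 < u / 2 := by positivity
  have h := (sq_gain_le hB hT hle hTm hT2 hL hLm hL2 hAB hBA hlow hu2 hy0 i).1
  have e1 : 2 * (u / 2) = u := by ring
  have e2 : u / 2 / 2 ^ i = u / 2 ^ (1 + i) := by rw [pow_add, pow_one]; ring
  rw [e1, e2] at h
  exact h

omit [IsStrictOrderedRing K] in
/-- SSE of the two-valued block `attBlock k A C = (A, C, …, C)`: one copy of the squared error of `A`
and `k - 1` copies of the squared error of `C` -/
theorem blockSSE_attBlock {k : ℕ} (hk : 1 ≤ k) (s A C : K) :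
    blockSSE hB s (attBlock k A C) = err hB s A ^ 2 + ((k : K) - 1) * err hB s C ^ 2 := by
  unfold blockSSE
  rw [← Finset.add_sum_erase _ _ (Finset.mem_univ (⟨0, hk⟩ : Fin k))]
  have h00 : (((⟨0, hk⟩ : Fin k) : ℕ)) = 0 := rfl
  have h' : ∀ i ∈ Finset.univ.erase (⟨0, hk⟩ : Fin k),
      err hB s (attBlock k A C i) ^ 2 = err hB s C ^ 2 := by
    intro i hi
    have hne : (i : ℕ) ≠ 0 := fun h => Finset.ne_of_mem_erase hi (Fin.ext h)
    rw [attBlock_of_ne hne]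
  rw [Finset.sum_congr rfl h', Finset.sum_const, Finset.card_erase_of_mem (Finset.mem_univ _),
    Finset.card_univ, Fintype.card_fin, nsmul_eq_mul, attBlock_of_eq h00, Nat.cast_sub hk,
    Nat.cast_one]

/-- the top element alone: going from the half candidate `u` (which clips `a > T u`) to ANY finer scale
`u / 2^j`, `j ≥ 1`, increases its squared error by more than `T² (u/2)²`
(`(a - T u/2)² - (a - T u)² - T² u²/4 = T u (a - T u) > 0`) -/
theorem top_sq_loss {T : ℕ} (hT : T ∈ B) (hle : ∀ n ∈ B, n ≤ T) (hT1 : 1 ≤ T) {u a : K}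
    (hu : 0 < u) (ha : (T : K) * u < a) {j : ℕ} (hj : 1 ≤ j) :
    (T : K) ^ 2 * (u / 2) ^ 2 + err hB u a ^ 2 < err hB (u / 2 ^ j) a ^ 2 := by
  have hT0 : (0 : K) < T := Nat.cast_pos.mpr hT1
  have e1 : err hB u a = a - (T : K) * u := err_eq_sub_top hB hT hle hu.le ha.le
  have hpow : (2 : K) ≤ 2 ^ j := by
    calc (2 : K) = 2 ^ 1 := (pow_one _).symm
      _ ≤ 2 ^ j := pow_le_pow_right₀ (by norm_num) hj
  have hdiv : u / 2 ^ j ≤ u / 2 := div_le_div_of_nonneg_left hu.le (by norm_num) hpow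
  have h2 : a - (T : K) * (u / 2) ≤ err hB (u / 2 ^ j) a := by
    have h := sub_top_le_err hB hle (s := u / 2 ^ j) (by positivity) a
    have hm : (T : K) * (u / 2 ^ j) ≤ (T : K) * (u / 2) := mul_le_mul_of_nonneg_left hdiv hT0.le
    linarith
  have h3 : 0 ≤ a - (T : K) * (u / 2) := by
    have hm : (T : K) * (u / 2) ≤ (T : K) * u := mul_le_mul_of_nonneg_left (by linarith) hT0.le
    linarith
  have h4 : (a - (T : K) * (u / 2)) ^ 2 ≤ err hB (u / 2 ^ j) a ^ 2 := pow_le_pow_left₀ h3 h2 2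
  have h5 : 0 < (T : K) * u * (a - (T : K) * u) := mul_pos (mul_pos hT0 hu) (by linarith)
  have e2 : (a - (T : K) * (u / 2)) ^ 2 - (a - (T : K) * u) ^ 2 - (T : K) ^ 2 * (u / 2) ^ 2 =
      (T : K) * u * (a - (T : K) * u) := by ring
  rw [e1]
  linarith

/-- **Theorem S4 (generic): for block sizes `k ≤ T² + 1`, every power-of-two scale finer than the half
candidate `u` is STRICTLY worse than `u` in block SSE** (block maximum `a > T u`, i.e. `u` clips `a`). -/
theorem sse_finer_lt_half {T Tm L Lm : ℕ} (hT : T ∈ B) (hle : ∀ n ∈ B, n ≤ T) (hTm : Tm ∈ B)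
    (hT2 : 2 * Tm = T) (hL : L ∈ B) (hLm : Lm ∈ B) (hL2 : 2 * Lm = L)
    (hAB : ∀ n ∈ B, L ≤ 2 * n → 2 * n ≤ T → 2 * n ∈ B)
    (hBA : ∀ n ∈ B, L ≤ n → n ≤ T → ∃ m ∈ B, 2 * m = n)
    (hlow : ∀ u y : K, 0 < u → 0 ≤ y → y ≤ (L : K) * u → err hB (2 * u) y ≤ u) (hT1 : 1 ≤ T)
    {k : ℕ} (x : Fin k → K) {u a : K} (hu : 0 < u) (hx0 : ∀ i, 0 ≤ x i)
    (ha' : (T : K) * u < a) (i₀ : Fin k) (hi₀ : x i₀ = a) (hk : k ≤ T ^ 2 + 1) {j : ℕ} (hj : 1 ≤ j) :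
    blockSSE hB u x < blockSSE hB (u / 2 ^ j) x := by
  have hk1 : 1 ≤ k := Fin.pos i₀
  have htop := top_sq_loss hB hT hle hT1 hu ha' hj
  have hrest : ∀ i, err hB u (x i) ^ 2 ≤ err hB (u / 2 ^ j) (x i) ^ 2 + (u / 2) ^ 2 := by
    intro i
    have := sq_gain_le_half hB hT hle hTm hT2 hL hLm hL2 hAB hBA hlow hu (hx0 i) hj (y := x i)
    linarith
  have hsum : ∑ i ∈ Finset.univ.erase i₀, err hB u (x i) ^ 2 ≤
      ∑ i ∈ Finset.univ.erase i₀, err hB (u / 2 ^ j) (x i) ^ 2 + ((k : K) - 1) * (u / 2) ^ 2 := by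
    have h := Finset.sum_le_sum (fun i (_ : i ∈ Finset.univ.erase i₀) => hrest i)
    rw [Finset.sum_add_distrib, Finset.sum_const, Finset.card_erase_of_mem (Finset.mem_univ _),
      Finset.card_univ, Fintype.card_fin, nsmul_eq_mul, Nat.cast_sub hk1, Nat.cast_one] at h
    exact h
  have hkT : ((k : K) - 1) * (u / 2) ^ 2 ≤ (T : K) ^ 2 * (u / 2) ^ 2 := by
    have : (k : K) ≤ (T : K) ^ 2 + 1 := by exact_mod_cast hk
    exact mul_le_mul_of_nonneg_right (by linarith) (by positivity)
  have e1 : blockSSE hB u x = err hB u a ^ 2 + ∑ i ∈ Finset.univ.erase i₀, err hB u (x i) ^ 2 := by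
    unfold blockSSE
    rw [← Finset.add_sum_erase _ _ (Finset.mem_univ i₀), hi₀]
  have e2 : blockSSE hB (u / 2 ^ j) x =
      err hB (u / 2 ^ j) a ^ 2 + ∑ i ∈ Finset.univ.erase i₀, err hB (u / 2 ^ j) (x i) ^ 2 := by
    unfold blockSSE
    rw [← Finset.add_sum_erase _ _ (Finset.mem_univ i₀), hi₀]
  rw [e1, e2]
  linarith

/-- **Theorem S4 (generic, the two candidates suffice): for `k ≤ T² + 1` the minimum of block SSE over
ALL power-of-two scales — `2^n (2u)` (coarser or equal), `u` (half), `2u / 2^n` with `n ≥ 2` (finer) —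
equals `min (SSE(2u), SSE(u))`.** -/
theorem sse_two_candidates {T Tm L Lm : ℕ} (hT : T ∈ B) (hle : ∀ n ∈ B, n ≤ T) (hTm : Tm ∈ B)
    (hT2 : 2 * Tm = T) (hL : L ∈ B) (hLm : Lm ∈ B) (hL2 : 2 * Lm = L)
    (hAB : ∀ n ∈ B, L ≤ 2 * n → 2 * n ≤ T → 2 * n ∈ B)
    (hBA : ∀ n ∈ B, L ≤ n → n ≤ T → ∃ m ∈ B, 2 * m = n)
    (hlow : ∀ u y : K, 0 < u → 0 ≤ y → y ≤ (L : K) * u → err hB (2 * u) y ≤ u)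
    (hdouble : ∀ n ∈ B, 2 * n ≤ T → 2 * n ∈ B) (hT1 : 1 ≤ T)
    {k : ℕ} (x : Fin k → K) {u a : K} (hu : 0 < u) (hx0 : ∀ i, 0 ≤ x i) (hxa : ∀ i, x i ≤ a)
    (ha : a ≤ (T : K) * (2 * u)) (ha' : (T : K) * u < a) (i₀ : Fin k) (hi₀ : x i₀ = a)
    (hk : k ≤ T ^ 2 + 1) (v : K)
    (hv : (∃ n : ℕ, v = 2 ^ n * (2 * u)) ∨ v = u ∨ (∃ n : ℕ, 2 ≤ n ∧ v = 2 * u / 2 ^ n)) :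
    min (blockSSE hB (2 * u) x) (blockSSE hB u x) ≤ blockSSE hB v x := by
  rcases hv with ⟨n, rfl⟩ | rfl | ⟨n, hn, rfl⟩
  · have hxT : ∀ i, x i ≤ (T : K) * (2 * u) := fun i => (hxa i).trans ha
    exact (min_le_left _ _).trans (sse_coarser_le hB hT hdouble x (by positivity) hxT n)
  · exact min_le_right _ _
  · obtain ⟨j, rfl⟩ := Nat.exists_eq_add_of_le hn
    have e : 2 * u / 2 ^ (2 + j) = u / 2 ^ (1 + j) := by
      rw [div_eq_div_iff (by positivity) (by positivity)]; ring
    rw [e]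
    exact (min_le_right _ _).trans
      (sse_finer_lt_half hB hT hle hTm hT2 hL hLm hL2 hAB hBA hlow hT1 x hu hx0 ha' i₀ hi₀ hk
        (j := 1 + j) (by omega)).le

/-- the tightness block of `sse_third_scale_wins` (maximum `A = T u + η`, the other `k - 1` elements at
`C = u/2`, where `u = 8 T η`): its block SSE at `u/2` (exact), at `u` and `2u` (lower bounds), and at every
`u/2^j`, `j ≥ 2` (lower bound), as polynomials in `T, η` -/
theorem third_scale_block_sse {T : ℕ} (hT : T ∈ B) (hle : ∀ n ∈ B, n ≤ T) (h1 : 1 ∈ B) (hT1 : 1 ≤ T)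
    (hdouble : ∀ n ∈ B, 2 * n ≤ T → 2 * n ∈ B) {k : ℕ} (hk1 : 1 ≤ k)
    (hkK : (T : K) ^ 2 + 1 ≤ (k : K) - 1) {η : K} (hη : 0 < η) {A C : K}
    (hA : A = (T : K) * (8 * (T : K) * η) + η) (hC : C = 8 * (T : K) * η / 2) :
    blockSSE hB (8 * (T : K) * η / 2) (attBlock k A C) =
        ((T : K) * (8 * (T : K) * η) + η - (T : K) * (8 * (T : K) * η / 2)) ^ 2 ∧
      ((T : K) * (8 * (T : K) * η) + η - (T : K) * (8 * (T : K) * η)) ^ 2 +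
          ((T : K) ^ 2 + 1) * (8 * (T : K) * η / 2) ^ 2 ≤
        blockSSE hB (8 * (T : K) * η) (attBlock k A C) ∧
      ((T : K) ^ 2 + 1) * (8 * (T : K) * η / 2) ^ 2 ≤
        blockSSE hB (2 * (8 * (T : K) * η)) (attBlock k A C) ∧
      (∀ j : ℕ, 2 ≤ j → ((T : K) * (8 * (T : K) * η) + η - (T : K) * (8 * (T : K) * η / 4)) ^ 2 ≤
        blockSSE hB (8 * (T : K) * η / 2 ^ j) (attBlock k A C)) := by
  have hk0 : (0 : K) ≤ (k : K) - 1 := le_trans (by positivity) hkK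
  have hT1' : (1 : K) ≤ T := by exact_mod_cast hT1
  have hT0 : (0 : K) < T := Nat.cast_pos.mpr hT1
  have hu : (0 : K) < 8 * (T : K) * η := by positivity
  have hu2 : (0 : K) ≤ 8 * (T : K) * η / 2 := by positivity
  have hη1 : η ≤ (T : K) * η := le_mul_of_one_le_left hη.le hT1'
  have hTT : (T : K) * η ≤ (T : K) * ((T : K) * η) := mul_le_mul_of_nonneg_left hη1 hT0.le
  have hTA : (T : K) * (8 * (T : K) * η) < A := by rw [hA]; exact lt_add_of_pos_right _ hη
  have hCT : C ≤ (T : K) * (8 * (T : K) * η) := by rw [hC]; linarith only [hη, hη1, hTT]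
  -- element errors
  have eF_A : err hB (8 * (T : K) * η / 2) A = A - (T : K) * (8 * (T : K) * η / 2) :=
    err_eq_sub_top hB hT hle hu2 (by rw [hA]; linarith only [hη, hη1, hTT])
  have eF_C : err hB (8 * (T : K) * η / 2) C = 0 := by
    apply le_antisymm
    · exact err_le_of_near_abs hB (r := 0) (n := 1) h1
        (by rw [hC]; push_cast; linarith only [hη]) (by rw [hC]; push_cast; linarith only [hη])
    · exact gridDist_nonneg _ _
  have eH_A : err hB (8 * (T : K) * η) A = A - (T : K) * (8 * (T : K) * η) :=
    err_eq_sub_top hB hT hle hu.le hTA.le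
  have eH_C : 8 * (T : K) * η / 2 ≤ err hB (8 * (T : K) * η) C := by
    have h := le_err_coarse_of_far hB (w := 1) (fun n _ => by omega) (u := 8 * (T : K) * η / 2)
      (by positivity)
    have e1 : 2 * (8 * (T : K) * η / 2) = 8 * (T : K) * η := by ring
    have e2 : ((1 : ℕ) : K) * (8 * (T : K) * η / 2) = C := by rw [hC]; push_cast; ring
    rw [e1, e2] at h
    exact h
  have eN_C : 8 * (T : K) * η / 2 ≤ err hB (2 * (8 * (T : K) * η)) C :=
    eH_C.trans (halving_le hB hT hdouble hu hCT)
  refine ⟨?_, ?_, ?_, fun j hj => ?_⟩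
  · rw [blockSSE_attBlock hB hk1, eF_A, eF_C, hA]; ring
  · rw [blockSSE_attBlock hB hk1, eH_A, hA]
    have h2 : (8 * (T : K) * η / 2) ^ 2 ≤ err hB (8 * (T : K) * η) C ^ 2 :=
      pow_le_pow_left₀ hu2 eH_C 2
    have h3 := mul_le_mul hkK h2 (sq_nonneg _) hk0
    linarith only [h3]
  · rw [blockSSE_attBlock hB hk1]
    have h2 : (8 * (T : K) * η / 2) ^ 2 ≤ err hB (2 * (8 * (T : K) * η)) C ^ 2 :=
      pow_le_pow_left₀ hu2 eN_C 2
    have h3 := mul_le_mul hkK h2 (sq_nonneg _) hk0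
    have h4 : 0 ≤ err hB (2 * (8 * (T : K) * η)) A ^ 2 := sq_nonneg _
    linarith only [h3, h4]
  · rw [blockSSE_attBlock hB hk1]
    have hpow : (4 : K) ≤ 2 ^ j := by
      calc (4 : K) = 2 ^ 2 := by norm_num
        _ ≤ 2 ^ j := pow_le_pow_right₀ (by norm_num) hj
    have hdiv : 8 * (T : K) * η / 2 ^ j ≤ 8 * (T : K) * η / 4 :=
      div_le_div_of_nonneg_left hu.le (by norm_num) hpow
    have hsj : (0 : K) ≤ 8 * (T : K) * η / 2 ^ j := div_nonneg hu.le (pow_nonneg (by norm_num) j)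
    have h2 : (T : K) * (8 * (T : K) * η) + η - (T : K) * (8 * (T : K) * η / 4) ≤
        err hB (8 * (T : K) * η / 2 ^ j) A := by
      have h := sub_top_le_err hB hle (s := 8 * (T : K) * η / 2 ^ j) hsj A
      have hm : (T : K) * (8 * (T : K) * η / 2 ^ j) ≤ (T : K) * (8 * (T : K) * η / 4) :=
        mul_le_mul_of_nonneg_left hdiv hT0.le
      linarith only [h, hm, hA]
    have h3 : 0 ≤ (T : K) * (8 * (T : K) * η) + η - (T : K) * (8 * (T : K) * η / 4) := by
      linarith only [hη, hη1, hTT]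
    have h4 := pow_le_pow_left₀ h3 h2 2
    have h5 : 0 ≤ ((k : K) - 1) * err hB (8 * (T : K) * η / 2 ^ j) C ^ 2 :=
      mul_nonneg hk0 (sq_nonneg _)
    linarith only [h4, h5]

/-- **Theorem S4, tightness (generic): for every `k ≥ T² + 2` the two candidates do NOT suffice.** For
the block `x = (T u + u/(8T), u/2, …, u/2)` of size `k` (maximum just above the clip point `T u` of the
half candidate, the other `k - 1 ≥ T² + 1` elements at the first midpoint `u/2` of the grid `u • B`), the
scale `u/2` (window `e_nc - 2`) is STRICTLY better in SSE than both candidates `2u`, `u`, than every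
coarser scale `2^n (2u)` and than every finer scale `u/2^j`, `j ≥ 2`: it is the unique SSE-optimal
power-of-two scale, so the threshold `T² + 1` of `sse_two_candidates` is exact. -/
theorem sse_third_scale_wins {T : ℕ} (hT : T ∈ B) (hle : ∀ n ∈ B, n ≤ T) (h1 : 1 ∈ B) (hT1 : 1 ≤ T)
    (hdouble : ∀ n ∈ B, 2 * n ≤ T → 2 * n ∈ B) {k : ℕ} (hk : T ^ 2 + 2 ≤ k) {u : K} (hu : 0 < u) :
    ∃ (x : Fin k → K) (i₀ : Fin k), (∀ i, 0 ≤ x i) ∧ (∀ i, x i ≤ x i₀) ∧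
      (T : K) * u < x i₀ ∧ x i₀ ≤ (T : K) * (2 * u) ∧
      blockSSE hB (u / 2) x < blockSSE hB (2 * u) x ∧ blockSSE hB (u / 2) x < blockSSE hB u x ∧
      (∀ n : ℕ, blockSSE hB (u / 2) x < blockSSE hB (2 ^ n * (2 * u)) x) ∧
      (∀ j : ℕ, 2 ≤ j → blockSSE hB (u / 2) x < blockSSE hB (u / 2 ^ j) x) := by
  have hk1 : 1 ≤ k := le_trans (by omega) hk
  have hkK : (T : K) ^ 2 + 1 ≤ (k : K) - 1 := by
    have h : ((T ^ 2 + 2 : ℕ) : K) ≤ k := by exact_mod_cast hk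
    push_cast at h
    linarith only [h]
  have hT1' : (1 : K) ≤ T := by exact_mod_cast hT1
  have hT0 : (0 : K) < T := Nat.cast_pos.mpr hT1
  -- write `u = 8 T η`, so that every quantity below is a polynomial in `T` and `η`
  obtain ⟨η, rfl⟩ : ∃ η : K, u = 8 * (T : K) * η :=
    ⟨u / (8 * (T : K)), by rw [mul_div_assoc', mul_comm, mul_div_assoc, div_self (by positivity),
      mul_one]⟩
  have hη : 0 < η := (mul_pos_iff_of_pos_left (by positivity : (0 : K) < 8 * (T : K))).1 hu
  have hη1 : η ≤ (T : K) * η := le_mul_of_one_le_left hη.le hT1'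
  have hTT : (T : K) * η ≤ (T : K) * ((T : K) * η) := mul_le_mul_of_nonneg_left hη1 hT0.le
  have p1 : 0 < (T : K) ^ 2 * η ^ 2 := by positivity
  have p2 : 0 ≤ (T : K) ^ 4 * η ^ 2 := by positivity
  have q1 : η ^ 2 ≤ ((T : K) * η) ^ 2 := pow_le_pow_left₀ hη.le hη1 2
  have h2u : (0 : K) < 2 * (8 * (T : K) * η) := by positivity
  -- the block: maximum `A = T u + η`, the other `k - 1` elements at `C = u / 2`
  obtain ⟨A, hA⟩ : ∃ A : K, A = (T : K) * (8 * (T : K) * η) + η := ⟨_, rfl⟩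
  obtain ⟨C, hC⟩ : ∃ C : K, C = 8 * (T : K) * η / 2 := ⟨_, rfl⟩
  have hA0 : 0 ≤ A := by rw [hA]; positivity
  have hC0 : 0 ≤ C := by rw [hC]; positivity
  have hCA : C ≤ A := by rw [hA, hC]; linarith only [hη, hη1, hTT]
  have hTA : (T : K) * (8 * (T : K) * η) < A := by rw [hA]; exact lt_add_of_pos_right _ hη
  have hA2 : A ≤ (T : K) * (2 * (8 * (T : K) * η)) := by rw [hA]; linarith only [hη, hη1, hTT]
  have h00 : (((⟨0, hk1⟩ : Fin k) : ℕ)) = 0 := rfl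
  obtain ⟨sF, sH, sN, sJ⟩ := third_scale_block_sse hB hT hle h1 hT1 hdouble hk1 hkK hη hA hC
  -- the comparisons (polynomial inequalities in `T, η`)
  have lt_nc : blockSSE hB (8 * (T : K) * η / 2) (attBlock k A C) <
      blockSSE hB (2 * (8 * (T : K) * η)) (attBlock k A C) := by
    rw [sF]; linarith only [sN, p1, q1]
  have lt_half : blockSSE hB (8 * (T : K) * η / 2) (attBlock k A C) <
      blockSSE hB (8 * (T : K) * η) (attBlock k A C) := by
    rw [sF]; linarith only [sH, p1]
  refine ⟨attBlock k A C, ⟨0, hk1⟩, fun i => ?_, fun i => ?_, ?_, ?_, lt_nc, lt_half, fun n => ?_,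
    fun j hj => ?_⟩
  · by_cases hi : (i : ℕ) = 0
    · rw [attBlock_of_eq hi]; exact hA0
    · rw [attBlock_of_ne hi]; exact hC0
  · rw [attBlock_of_eq h00]
    by_cases hi : (i : ℕ) = 0
    · rw [attBlock_of_eq hi]
    · rw [attBlock_of_ne hi]; exact hCA
  · rw [attBlock_of_eq h00]; exact hTA
  · rw [attBlock_of_eq h00]; exact hA2
  · have hxT : ∀ i, attBlock k A C i ≤ (T : K) * (2 * (8 * (T : K) * η)) := by
      intro i
      by_cases hi : (i : ℕ) = 0
      · rw [attBlock_of_eq hi]; exact hA2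
      · rw [attBlock_of_ne hi]; exact hCA.trans hA2
    exact lt_of_lt_of_le lt_nc (sse_coarser_le hB hT hdouble (attBlock k A C) h2u hxT n)
  · rw [sF]; linarith only [sJ j hj, p1, p2]

end SSEWindow

section SSEWindowInstances

variable {K : Type*} [Field K] [LinearOrder K] [IsStrictOrderedRing K]

/-- **Theorem S4 for FP4 / E2M1 (`T = 12`, `K₂ = 145`): for blocks of size `k ≤ 145` with maximum in
`(12 u, 24 u]`, the minimum of block SSE over all power-of-two scales is attained at one of the two
candidates `2u` (non-clipping) or `u` (its half).** -/
theorem sse_two_candidates_e2m1 {k : ℕ} (x : Fin k → K) {u a : K} (hu : 0 < u) (hx0 : ∀ i, 0 ≤ x i)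
    (hxa : ∀ i, x i ≤ a) (ha : a ≤ ((12 : ℕ) : K) * (2 * u)) (ha' : ((12 : ℕ) : K) * u < a)
    (i₀ : Fin k) (hi₀ : x i₀ = a) (hk : k ≤ 145) (v : K)
    (hv : (∃ n : ℕ, v = 2 ^ n * (2 * u)) ∨ v = u ∨ (∃ n : ℕ, 2 ≤ n ∧ v = 2 * u / 2 ^ n)) :
    min (blockSSE e2m1Lo_ne (2 * u) x) (blockSSE e2m1Lo_ne u x) ≤ blockSSE e2m1Lo_ne v x :=
  sse_two_candidates e2m1Lo_ne (T := 12) (Tm := 6) (L := 4) (Lm := 2) (by decide) (by decide)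
    (by decide) (by norm_num) (by decide) (by decide) (by norm_num) (by decide) (by decide)
    (fun u y hu hy0 hy => e2m1_lowcov hu hy0 (by simpa using hy)) (by decide) (by norm_num)
    x hu hx0 hxa ha ha' i₀ hi₀ (hk.trans (by norm_num)) v hv

/-- **Theorem S4 for FP6 / E2M3 (`T = 60`, `K₂ = 3601`).** -/
theorem sse_two_candidates_e2m3 {k : ℕ} (x : Fin k → K) {u a : K} (hu : 0 < u) (hx0 : ∀ i, 0 ≤ x i)
    (hxa : ∀ i, x i ≤ a) (ha : a ≤ ((60 : ℕ) : K) * (2 * u)) (ha' : ((60 : ℕ) : K) * u < a)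
    (i₀ : Fin k) (hi₀ : x i₀ = a) (hk : k ≤ 3601) (v : K)
    (hv : (∃ n : ℕ, v = 2 ^ n * (2 * u)) ∨ v = u ∨ (∃ n : ℕ, 2 ≤ n ∧ v = 2 * u / 2 ^ n)) :
    min (blockSSE e2m3Lo_ne (2 * u) x) (blockSSE e2m3Lo_ne u x) ≤ blockSSE e2m3Lo_ne v x :=
  sse_two_candidates e2m3Lo_ne (T := 60) (Tm := 30) (L := 16) (Lm := 8) (by decide) (by decide)
    (by decide) (by norm_num) (by decide) (by decide) (by norm_num) (by decide) (by decide)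
    (fun u y hu hy0 hy => e2m3_lowcov hu hy0 (by simpa using hy)) (by decide) (by norm_num)
    x hu hx0 hxa ha ha' i₀ hi₀ (hk.trans (by norm_num)) v hv

/-- **Theorem S4 for FP6 / E3M2 (`T = 448`, `K₂ = 200705`).** -/
theorem sse_two_candidates_e3m2 {k : ℕ} (x : Fin k → K) {u a : K} (hu : 0 < u) (hx0 : ∀ i, 0 ≤ x i)
    (hxa : ∀ i, x i ≤ a) (ha : a ≤ ((448 : ℕ) : K) * (2 * u)) (ha' : ((448 : ℕ) : K) * u < a)
    (i₀ : Fin k) (hi₀ : x i₀ = a) (hk : k ≤ 200705) (v : K)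
    (hv : (∃ n : ℕ, v = 2 ^ n * (2 * u)) ∨ v = u ∨ (∃ n : ℕ, 2 ≤ n ∧ v = 2 * u / 2 ^ n)) :
    min (blockSSE e3m2Lo_ne (2 * u) x) (blockSSE e3m2Lo_ne u x) ≤ blockSSE e3m2Lo_ne v x :=
  sse_two_candidates e3m2Lo_ne (T := 448) (Tm := 224) (L := 8) (Lm := 4) (by decide) (by decide)
    (by decide) (by norm_num) (by decide) (by decide) (by norm_num) (by decide) (by decide)
    (fun u y hu hy0 hy => e3m2_lowcov hu hy0 (by simpa using hy)) (by decide) (by norm_num)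
    x hu hx0 hxa ha ha' i₀ hi₀ (hk.trans (by norm_num)) v hv

/-- **Theorem S4, tightness for FP4 / E2M1: for every `k ≥ 146` there is a block of size `k` with maximum
in `(12 u, 24 u]` on which the scale `u/2` is strictly better in SSE than both candidates and than every
other power-of-two scale** — so `K₂(E2M1) = 145` is exact. -/
theorem sse_third_scale_wins_e2m1 {k : ℕ} (hk : 146 ≤ k) {u : K} (hu : 0 < u) :
    ∃ (x : Fin k → K) (i₀ : Fin k), (∀ i, 0 ≤ x i) ∧ (∀ i, x i ≤ x i₀) ∧
      ((12 : ℕ) : K) * u < x i₀ ∧ x i₀ ≤ ((12 : ℕ) : K) * (2 * u) ∧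
      blockSSE e2m1Lo_ne (u / 2) x < blockSSE e2m1Lo_ne (2 * u) x ∧
      blockSSE e2m1Lo_ne (u / 2) x < blockSSE e2m1Lo_ne u x ∧
      (∀ n : ℕ, blockSSE e2m1Lo_ne (u / 2) x < blockSSE e2m1Lo_ne (2 ^ n * (2 * u)) x) ∧
      (∀ j : ℕ, 2 ≤ j → blockSSE e2m1Lo_ne (u / 2) x < blockSSE e2m1Lo_ne (u / 2 ^ j) x) :=
  sse_third_scale_wins e2m1Lo_ne (T := 12) (by decide) (by decide) (by decide) (by norm_num)
    (by decide) (le_trans (by norm_num) hk) hu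

/-- **Theorem S4, tightness for FP6 / E2M3: `K₂(E2M3) = 3601` is exact** (blocks of every size `≥ 3602`). -/
theorem sse_third_scale_wins_e2m3 {k : ℕ} (hk : 3602 ≤ k) {u : K} (hu : 0 < u) :
    ∃ (x : Fin k → K) (i₀ : Fin k), (∀ i, 0 ≤ x i) ∧ (∀ i, x i ≤ x i₀) ∧
      ((60 : ℕ) : K) * u < x i₀ ∧ x i₀ ≤ ((60 : ℕ) : K) * (2 * u) ∧
      blockSSE e2m3Lo_ne (u / 2) x < blockSSE e2m3Lo_ne (2 * u) x ∧
      blockSSE e2m3Lo_ne (u / 2) x < blockSSE e2m3Lo_ne u x ∧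
      (∀ n : ℕ, blockSSE e2m3Lo_ne (u / 2) x < blockSSE e2m3Lo_ne (2 ^ n * (2 * u)) x) ∧
      (∀ j : ℕ, 2 ≤ j → blockSSE e2m3Lo_ne (u / 2) x < blockSSE e2m3Lo_ne (u / 2 ^ j) x) :=
  sse_third_scale_wins e2m3Lo_ne (T := 60) (by decide) (by decide) (by decide) (by norm_num)
    (by decide) (le_trans (by norm_num) hk) hu

/-- **Theorem S4, tightness for FP6 / E3M2: `K₂(E3M2) = 200705` is exact** (blocks of every size
`≥ 200706`). -/
theorem sse_third_scale_wins_e3m2 {k : ℕ} (hk : 200706 ≤ k) {u : K} (hu : 0 < u) :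
    ∃ (x : Fin k → K) (i₀ : Fin k), (∀ i, 0 ≤ x i) ∧ (∀ i, x i ≤ x i₀) ∧
      ((448 : ℕ) : K) * u < x i₀ ∧ x i₀ ≤ ((448 : ℕ) : K) * (2 * u) ∧
      blockSSE e3m2Lo_ne (u / 2) x < blockSSE e3m2Lo_ne (2 * u) x ∧
      blockSSE e3m2Lo_ne (u / 2) x < blockSSE e3m2Lo_ne u x ∧
      (∀ n : ℕ, blockSSE e3m2Lo_ne (u / 2) x < blockSSE e3m2Lo_ne (2 ^ n * (2 * u)) x) ∧
      (∀ j : ℕ, 2 ≤ j → blockSSE e3m2Lo_ne (u / 2) x < blockSSE e3m2Lo_ne (u / 2 ^ j) x) :=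
  sse_third_scale_wins e3m2Lo_ne (T := 448) (by decide) (by decide) (by decide) (by norm_num)
    (by decide) (le_trans (by norm_num) hk) hu

end SSEWindowInstances

end Summit.Ventures.CertifiedArithmetic.LowPrec.Opt
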